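import Literature.Analysis.FluidPDE.NSBoundedHigherRegularityQuantProofs
import Literature.Analysis.FluidPDE.SereginZajaczkowski2007Leaves
import Literature.Analysis.FluidPDE.SereginZajaczkowski2007SwirlL4Holds
import Literature.Analysis.FluidPDE.SereginSverakLocalHolderBoundHolds
import Literature.Analysis.FluidPDE.KNSSThm53OfWindow
import Literature.Analysis.FluidPDE.KNSSTypeIRateLiouvilleHolds
import Literature.Analysis.FluidPDE.LerayLocalRegularH1Proofs
import Literature.Analysis.FluidPDE.SereginEpsilonRegularityHolds
import Literature.Analysis.FluidPDE.CKNEpsilonRegularityHolds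
import Literature.Analysis.FluidPDE.KNSSNoAxisymmetricTypeIReduced
import HarnessLib

/-!
# No axisymmetric Type I blow-up (ns.S24) and the Seregin–Šverák off-axis bounds — discharged

Analysis/FluidPDE theorem-only glue file (no definitions, no named facts). The
quantitative higher interior regularity of bounded distributional solutions is now a theorem of
the tree (`NSBoundedHigherRegularityBounds_holds`, `NSBoundedHigherRegularityQuantProofs.lean`;
Seregin–Šverák 2009 §2 p. 8, Serrin 1962). It was the last open leaf of the accepted reductions
of the whole axisymmetric Type I chain, which this file therefore closes by composition:

* `NSBoundedHigherRegularity_holds` — the qualitative statement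
  (`NSBoundedHigherRegularityBounds.nsBoundedHigherRegularity`);
* `seregin2014_lemma61_gradient_holds` (Seregin 2014 Lemma 6.1, `k = 2`),
  `SereginZajaczkowski2007.L6EpsilonRegularity_holds` (SZ 2007 Lemma 2.3),
  `SereginZajaczkowski2007.OffAxisSupBound_holds` (SZ 2007 Prop. 4.1) — by the accepted
  `…_of_higherRegularityBounds` / `…_of_leaves` reductions
  (`SereginZajaczkowski2007Leaves.lean`, `SereginEpsilonRegularityGradientOfBounds.lean`) with
  `SwirlL4EnergyBound_holds`;
* `SereginSverak2009.UnitScaleOffAxisBound_holds`, `SereginSverak2009.OffAxisBound_holds`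
  ((as15) and the display after it), `SereginSverak2009.AxisDecayBound_holds` (Prop. 3.7) —
  by the accepted `…_of_leaves` reductions of `SereginSverakOffAxisLeaves.lean`;
* `axisymmetric_typeI_bounded_holds` and **`knss_no_axisymmetric_typeI_holds`** (ns.S24;
  KNSS 2009 Thms 6.1–6.2, Seregin–Šverák 2009 Thms 1.1–1.2) — by
  `knss_no_axisymmetric_typeI_of_printed` (`KNSSNoAxisymmetricTypeIReduced.lean`) fed with
  `KNSS2009_regularity_bound_C_over_r_holds`, `leray_local_regular_H1_holds`, the barrier
  statement obtained from `axisymmetricTypeIExclusion_of_offAxisBound_of_localHolderBound`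
  (`Barriers/NavierStokesRegularity/AxisymmetricTypeIExclusionProofs.lean`) with
  `OffAxisBound_holds`, `LocalHolderBound_holds`, `KNSS2009_liouville_bound_C_over_r_holds`,
  and `seregin2014_thm14_holds`, `lemarieRieusset_epsilon_regularity_holds`.

The barrier's own discharge `AxisymmetricTypeIExclusion_holds` (namespace
`Literature.Barriers.NavierStokesRegularity`) belongs to the barrier's directory (namespace =
path, CONVENTIONS §2) and is filed there separately, importing this file; here the barrier
statement is only an intermediate term (`axisymmetricTypeIExclusion_of_tree`).

## References

* G. Koch, N. Nadirashvili, G. Seregin, V. Šverák, *Liouville theorems for the Navier–Stokes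
  equations and applications*, Acta Math. 203 (2009), Thms 6.1–6.2.
  [KochNadirashviliSereginSverak2009]
* G. Seregin, V. Šverák, *On Type I singularities of the local axi-symmetric solutions of the
  Navier–Stokes equations*, Comm. PDE 34 (2009), Thm. 3.1, Prop. 3.7, §2 p. 8.
  [SereginSverak2009]
* G. Seregin, W. Zajaczkowski, SIAM J. Math. Anal. 39 (2007), Lemma 2.3, Prop. 4.1.
  [SereginZajaczkowski2007]
* G. Seregin, *Lecture notes on regularity theory for the Navier–Stokes equations* (2014),
  Ch. 6, Lemma 6.1. [Seregin2014]
-/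

noncomputable section

namespace Literature.Analysis.FluidPDE

/-! ### Higher interior regularity of bounded solutions, qualitative form -/

/-- **Higher interior regularity of essentially bounded distributional solutions, PROVED**
(the named fact `NSBoundedHigherRegularity`, Seregin–Šverák 2009 §2 p. 8): immediate from the
quantitative theorem `NSBoundedHigherRegularityBounds_holds` by
`NSBoundedHigherRegularityBounds.nsBoundedHigherRegularity`. [cite: SereginSverak2009, §2 p. 8] -/
theorem NSBoundedHigherRegularity_holds : NSBoundedHigherRegularity :=
  NSBoundedHigherRegularityBounds.nsBoundedHigherRegularity NSBoundedHigherRegularityBounds_holds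

/-- **Seregin 2014, Ch. 6, Lemma 6.1, gradient case (`seregin2014_lemma61_gradient`), PROVED**:
the accepted reduction `seregin2014_lemma61_gradient_of_higherRegularityBounds` applied to
`NSBoundedHigherRegularityBounds_holds`.
[cite: Seregin2014, Ch. 6 §6.1 Lemma 6.1 (case k = 2)] -/
theorem seregin2014_lemma61_gradient_holds : seregin2014_lemma61_gradient :=
  seregin2014_lemma61_gradient_of_higherRegularityBounds NSBoundedHigherRegularityBounds_holds

namespace SereginZajaczkowski2007

/-- **Seregin–Zajaczkowski 2007, Lemma 2.3 (`L6EpsilonRegularity`), PROVED**: the accepted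
reduction `l6EpsilonRegularity_of_higherRegularityBounds` applied to
`NSBoundedHigherRegularityBounds_holds`. [cite: SereginZajaczkowski2007, Lemma 2.3] -/
theorem L6EpsilonRegularity_holds : L6EpsilonRegularity :=
  l6EpsilonRegularity_of_higherRegularityBounds NSBoundedHigherRegularityBounds_holds

/-- **Seregin–Zajaczkowski 2007, Proposition 4.1 (`OffAxisSupBound`), PROVED**: the accepted
reduction `offAxisSupBound_of_leaves` applied to `SwirlL4EnergyBound_holds` ((4.18)) and
`NSBoundedHigherRegularityBounds_holds`. [cite: SereginZajaczkowski2007, Prop. 4.1] -/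
theorem OffAxisSupBound_holds : OffAxisSupBound :=
  offAxisSupBound_of_leaves SwirlL4EnergyBound_holds NSBoundedHigherRegularityBounds_holds

end SereginZajaczkowski2007

namespace SereginSverak2009

/-- **Seregin–Šverák 2009, proof of Prop. 3.7, (as15) (`UnitScaleOffAxisBound`), PROVED**: the
accepted reduction `unitScaleOffAxisBound_of_leaves` applied to
`SereginZajaczkowski2007.SwirlL4EnergyBound_holds` and `NSBoundedHigherRegularity_holds`.
[cite: SereginSverak2009, proof of Prop. 3.7, (as15) (arXiv p. 10)] -/
theorem UnitScaleOffAxisBound_holds : UnitScaleOffAxisBound :=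
  unitScaleOffAxisBound_of_leaves SereginZajaczkowski2007.SwirlL4EnergyBound_holds
    NSBoundedHigherRegularity_holds

/-- **Seregin–Šverák 2009, the off-axis bound after (as15) (`OffAxisBound`), PROVED**: the
accepted reduction `offAxisBound_of_leaves` applied to
`SereginZajaczkowski2007.SwirlL4EnergyBound_holds` and `NSBoundedHigherRegularity_holds`.
[cite: SereginSverak2009, proof of Prop. 3.7, the display after (as15) (arXiv p. 10)] -/
theorem OffAxisBound_holds : OffAxisBound :=
  offAxisBound_of_leaves SereginZajaczkowski2007.SwirlL4EnergyBound_holds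
    NSBoundedHigherRegularity_holds

/-- **Seregin–Šverák 2009, Proposition 3.7 (`AxisDecayBound`: `|x'| |v| ≤ C₁` a.e. on
`Q(1/8)`), PROVED**: the accepted reduction `axisDecayBound_of_leaves` applied to
`SereginZajaczkowski2007.SwirlL4EnergyBound_holds` and `NSBoundedHigherRegularity_holds`.
[cite: SereginSverak2009, Prop. 3.7 (arXiv p. 10)] -/
theorem AxisDecayBound_holds : AxisDecayBound :=
  axisDecayBound_of_leaves SereginZajaczkowski2007.SwirlL4EnergyBound_holds
    NSBoundedHigherRegularity_holds

end SereginSverak2009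

/-! ### ns.S24: no axisymmetric Type I blow-up -/

open Literature.Barriers.NavierStokesRegularity in
/-- **Seregin–Šverák 2009, Thm. 3.1 in the barrier's phrasing, as an intermediate term**
(`Literature.Barriers.NavierStokesRegularity.AxisymmetricTypeIExclusion`; its `_holds` under the
barrier's own name is filed in the barrier directory): the accepted three-leaf reduction
`axisymmetricTypeIExclusion_of_offAxisBound_of_localHolderBound` with
`SereginSverak2009.OffAxisBound_holds`, `SereginSverak2009.LocalHolderBound_holds` and
`KNSS2009_liouville_bound_C_over_r_holds`. [cite: SereginSverak2009, Thm. 3.1 (= Thm. 1.1)] -/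
theorem axisymmetricTypeIExclusion_of_tree : AxisymmetricTypeIExclusion :=
  axisymmetricTypeIExclusion_of_offAxisBound_of_localHolderBound
    SereginSverak2009.OffAxisBound_holds SereginSverak2009.LocalHolderBound_holds
    KNSS2009_liouville_bound_C_over_r_holds

/-- **The boundedness form of the exclusion of axisymmetric Type I blow-up
(`axisymmetric_typeI_bounded`), PROVED**: `axisymmetric_typeI_bounded_of_literature` with the
barrier statement `axisymmetricTypeIExclusion_of_tree`, `seregin2014_thm14_holds` and
`lemarieRieusset_epsilon_regularity_holds`. [cite: SereginSverak2009, Thm 3.1 (= Thm 1.1)] -/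
theorem axisymmetric_typeI_bounded_holds : axisymmetric_typeI_bounded :=
  axisymmetric_typeI_bounded_of_literature axisymmetricTypeIExclusion_of_tree
    seregin2014_thm14_holds lemarieRieusset_epsilon_regularity_holds

/-- **ns.S24 — no axisymmetric Type I blow-up (`knss_no_axisymmetric_typeI`), PROVED**
(Koch–Nadirashvili–Seregin–Šverák 2009, Thms 6.1–6.2; Seregin–Šverák 2009,
Thms 1.1–1.2): the accepted reduction `knss_no_axisymmetric_typeI_of_printed` applied to
`KNSS2009_regularity_bound_C_over_r_holds` (Thm. 6.1), `leray_local_regular_H1_holds`, the barrier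
statement `axisymmetricTypeIExclusion_of_tree` (SS Thm. 3.1), `seregin2014_thm14_holds` and
`lemarieRieusset_epsilon_regularity_holds`.
[cite: KochNadirashviliSereginSverak2009, Thms 6.1–6.2 (§6, arXiv pp. 11–13)] -/
theorem knss_no_axisymmetric_typeI_holds : knss_no_axisymmetric_typeI :=
  knss_no_axisymmetric_typeI_of_printed KNSS2009_regularity_bound_C_over_r_holds
    leray_local_regular_H1_holds axisymmetricTypeIExclusion_of_tree seregin2014_thm14_holds
    lemarieRieusset_epsilon_regularity_holds

end Literature.Analysis.FluidPDE

end
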